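import Mathlib.RingTheory.MvPolynomial.WeightedHomogeneous
import Mathlib.RingTheory.Localization.Away.Basic
import Mathlib.RingTheory.Ideal.Quotient.Operations
import Mathlib.RingTheory.Ideal.Maps
import Mathlib.Data.ZMod.Basic
import Literature.AlgebraicGeometry.Resolution.AffineBlowupAlgebra
import HarnessLib

/-!
# The image of a weighted blow-up chart is the weight-`0̄` subalgebra (crux `FInjectiveMacaulayfication`, line `Sketch`)

Support file for crux stmt-ResolutionOfSingularities-15315 (`FrobeniusLadder.FInjectiveMacaulayfication`,
line `Sketch`), stub `stub_weightedChartImage` of the cycle-9 WEIGHTED CONE ENGINE (§15 of the registered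
skeleton 10f06f91). [OURS · L1 W4.5a] — a statement about OUR route's objects, not a statement of any manuscript.

Setting. `k` a field, `P = k[X₀,…,X_{n-1}]`, weights `w : Fin n → ℕ`, a chart index `v` with `0 < w v`,
`N = c · w v` with `0 < c`, and `I_N ⊆ P` the ideal spanned by the monomials `X^b` of weighted degree
`weight w b ≥ N`, assumed VERONESE-SATURATED (`X^b ∈ I_N^K` whenever `weight w b ≥ K N`). The ROOT-COVER
SUBSTITUTION of the chart `v` is the `k`-algebra map `θ = θ_v : P → P`, `X_v ↦ X_v^{w_v}`, `X_j ↦ X_j X_v^{w_j}`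
(`j ≠ v`); it makes `P` graded by `ℤ/w_v` through `W = (X_v ↦ 1, X_j ↦ -w_j)`, and `θ(P)` lies in weighted
degree `0̄`. For hypersurfaces `f, g ∈ P` and a ring map
`Θ : (P/(f))[1/x_v^c] → (P/(g))[1/x_v]` compatible with `θ` on `P/(f)` (in the engine, `θ f = X_v^D g` and `Θ`
is the induced chart map), and `A ⊆ P/(g)` the image of the weighted-degree-`0̄` polynomials, THIS FILE PROVES

* `stub_weightedChartImage` — **`Θ` maps the affine blow-up algebra `(P/(f))[I_N/x_v^c] ⊆ (P/(f))[1/x_v^c]`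
  ONTO `A` (inside `(P/(g))[1/x_v]`)**: every element of the blow-up algebra is sent into the image of `A`, and
  every element of `A` is hit.

Proof. (⊆) `Literature…blowupAlgebra I a = Algebra.adjoin (P/(f)) {y/a : y ∈ I}`; induct (`Algebra.adjoin_induction`):
scalars `mk s` go to `mk (θ s)`, of degree `0̄` (`isWeightedHomogeneous_rootCover`); a generator `mk u / x_v^c`,
`u ∈ I_N`, goes to `mk (θ u) · x_v^{-N}` and `θ u = X_v^N · V` with `V` of degree `0̄`
(`exists_factor_of_mem_span`: on a monomial `X^b`, `θ X^b = X_v^{weight w b} · X^{b - b_v e_v}`, and for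
`weight w b ≥ N` the cofactor `X_v^{weight w b - N} X^{b - b_v e_v}` has `W`-degree `w_v b_v - N = 0̄`); sums and
products are clear. (⊇) For `U` of degree `0̄` every monomial `X^b` of `U` has `b_v ≡ Σ_{j ≠ v} w_j b_j (mod w_v)`,
so for `t` large (`N t ≥ Σ_{j≠v} w_j b_j` for all `b` in the support) the exponent
`a(b) = (b - b_v e_v) + ((N t + b_v - Σ_{j≠v} w_j b_j)/w_v) e_v` is integral, `weight w a(b) = N t + b_v ≥ N t`
(so `X^{a(b)} ∈ I_N^t` by saturation) and `θ X^{a(b)} = X_v^{N t} X^b`; hence `H = Σ_b U_b X^{a(b)} ∈ I_N^t` has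
`θ H = X_v^{N t} U` (`exists_lift_of_isWeightedHomogeneous`), and `z = mk H / (x_v^c)^t` lies in the blow-up
algebra (`algebraMap_mul_invSelf_pow_mem_blowupAlgebra`, Stacks 052Q) with `Θ z = mk U`.

All proofs are glue on Mathlib (`MvPolynomial.aeval_monomial`, `Finsupp.weight`, `MvPolynomial.IsWeightedHomogeneous`,
`IsLocalization.Away.invSelf`) and the tree's `Literature.AlgebraicGeometry.Resolution.AffineBlowupAlgebra`; no
definitions, no named facts. [folklore]

## References

* The Stacks Project, Tag 052Q (affine blow-up algebra: elements `x/aⁿ`, `x ∈ Iⁿ`). [StacksProject]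
* M. Reid, *Young person's guide to canonical singularities*, Proc. Sympos. Pure Math. 46 (1987), §4 (weighted
  blow-ups via cyclic covers / invariants of `μ_r`); folklore.
-/

-- single-problem summit: the doubled namespace component is forced
set_option linter.dupNamespace false

noncomputable section

namespace Summit.ResolutionOfSingularities.ResolutionOfSingularities.Theorems.FInjectiveMacaulayfication.WeightedChartImage

open MvPolynomial Literature.AlgebraicGeometry.Resolution

variable {k : Type} [Field k] {n : ℕ}

/-! ## Exponent-vector bookkeeping along the chart variable `v` -/

/-- `weight w d = weight w (d - d_v e_v) + d_v · w_v`. [folklore] -/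
theorem weight_eq_erase_add (w : Fin n → ℕ) (v : Fin n) (d : Fin n →₀ ℕ) :
    Finsupp.weight w d = Finsupp.weight w (d.erase v) + d v * w v := by
  conv_lhs => rw [← Finsupp.erase_add_single v d]
  rw [map_add, Finsupp.weight_single, smul_eq_mul]

/-- For an exponent vector `d` not involving `X_v`, its `W`-degree (`W = (X_v ↦ 1, X_j ↦ -w_j)` with values in
`ℤ/w_v`) is `-(weight w d)`. [folklore] -/
theorem weightW_of_apply_eq_zero (w : Fin n → ℕ) (v : Fin n) (W : Fin n → ZMod (w v))
    (hW : W = fun j : Fin n => if j = v then (1 : ZMod (w v)) else -((w j : ℕ) : ZMod (w v)))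
    (d : Fin n →₀ ℕ) (hd : d v = 0) :
    Finsupp.weight W d = -((Finsupp.weight w d : ℕ) : ZMod (w v)) := by
  rw [Finsupp.weight_apply, Finsupp.weight_apply, Finsupp.sum, Finsupp.sum, Nat.cast_sum,
    ← Finset.sum_neg_distrib]
  refine Finset.sum_congr rfl fun j hj => ?_
  have hjv : j ≠ v := by
    rintro rfl
    exact (Finsupp.mem_support_iff.mp hj) hd
  rw [hW]
  simp only [hjv, if_false, smul_eq_mul, Nat.cast_mul, nsmul_eq_mul, mul_neg]

/-- The `W`-degree of any exponent vector: `weight W d = d_v - weight w (d - d_v e_v)` in `ℤ/w_v`. [folklore] -/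
theorem weightW_eq (w : Fin n → ℕ) (v : Fin n) (W : Fin n → ZMod (w v))
    (hW : W = fun j : Fin n => if j = v then (1 : ZMod (w v)) else -((w j : ℕ) : ZMod (w v)))
    (d : Fin n →₀ ℕ) :
    Finsupp.weight W d = ((d v : ℕ) : ZMod (w v)) - ((Finsupp.weight w (d.erase v) : ℕ) : ZMod (w v)) := by
  conv_lhs => rw [← Finsupp.erase_add_single v d]
  rw [map_add, Finsupp.weight_single, weightW_of_apply_eq_zero w v W hW (d.erase v) (Finsupp.erase_same),
    hW]
  simp only [if_true, nsmul_eq_mul, mul_one]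
  ring

/-- `X^d = X_v^{d_v} · X^{d - d_v e_v}` (with coefficient `r`). [folklore] -/
theorem monomial_eq_C_mul_X_pow_mul (v : Fin n) (d : Fin n →₀ ℕ) (r : k) :
    (monomial d r : MvPolynomial (Fin n) k) = C r * X v ^ (d v) * monomial (d.erase v) 1 := by
  conv_lhs => rw [← mul_one r, ← C_mul_monomial, ← Finsupp.erase_add_single v d]
  rw [← mul_one (1 : k), ← monomial_mul, ← X_pow_eq_monomial, mul_one]
  ring

/-- **The root-cover substitution on monomials**: `θ_v (r X^d) = r · X_v^{weight w d} · X^{d - d_v e_v}`. [folklore] -/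
theorem aeval_rootCover_monomial (w : Fin n → ℕ) (v : Fin n) (d : Fin n →₀ ℕ) (r : k) :
    MvPolynomial.aeval (fun j : Fin n => if j = v then (MvPolynomial.X v : MvPolynomial (Fin n) k) ^ (w v)
      else MvPolynomial.X j * MvPolynomial.X v ^ (w j)) (monomial d r) =
      C r * X v ^ (Finsupp.weight w d) * monomial (d.erase v) 1 := by
  classical
  rw [MvPolynomial.aeval_monomial, MvPolynomial.algebraMap_eq,
    Finsupp.prod_fintype _ _ (fun i => pow_zero _), mul_assoc]
  congr 1
  have hpt : ∀ i : Fin n, (if i = v then (X v : MvPolynomial (Fin n) k) ^ (w v) else X i * X v ^ (w i)) ^ (d i)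
      = X i ^ ((d.erase v) i) * X v ^ (d i * w i) := by
    intro i
    rw [Finsupp.erase_apply]
    split_ifs with h
    · subst h
      rw [pow_zero, one_mul, mul_comm, pow_mul]
    · rw [mul_pow, ← pow_mul, mul_comm (w i)]
  rw [Finset.prod_congr rfl (fun i _ => hpt i), Finset.prod_mul_distrib, Finset.prod_pow_eq_pow_sum,
    mul_comm]
  congr 2
  · rw [Finsupp.weight_apply, Finsupp.sum_fintype]
    · simp only [smul_eq_mul]
    · intro i
      exact zero_smul ℕ _
  · rw [MvPolynomial.monomial_eq, C_1, one_mul, Finsupp.prod_fintype _ _ (fun i => pow_zero _)]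

/-- **`θ_v` lands in `W`-degree `0̄`** (`θ X_v = X_v^{w_v}` has degree `w_v · 1 = 0̄`, `θ X_j = X_j X_v^{w_j}` has
degree `-w_j + w_j = 0̄`). [folklore] -/
theorem isWeightedHomogeneous_rootCover (w : Fin n → ℕ) (v : Fin n) (W : Fin n → ZMod (w v))
    (hW : W = fun j : Fin n => if j = v then (1 : ZMod (w v)) else -((w j : ℕ) : ZMod (w v)))
    (s : MvPolynomial (Fin n) k) :
    IsWeightedHomogeneous W (MvPolynomial.aeval (fun j : Fin n => if j = v then
      (MvPolynomial.X v : MvPolynomial (Fin n) k) ^ (w v) else MvPolynomial.X j * MvPolynomial.X v ^ (w j)) s) 0 := by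
  induction s using MvPolynomial.induction_on with
  | C r =>
    rw [MvPolynomial.aeval_C, MvPolynomial.algebraMap_eq]
    exact isWeightedHomogeneous_C W r
  | add p q hp hq =>
    rw [map_add]
    exact hp.add hq
  | mul_X p j hp =>
    rw [map_mul, MvPolynomial.aeval_X]
    have hj : IsWeightedHomogeneous W (if j = v then (X v : MvPolynomial (Fin n) k) ^ (w v)
        else X j * X v ^ (w j)) 0 := by
      split_ifs with h
      · have h1 := (isWeightedHomogeneous_X (R := k) W v).pow (w v)
        have h2 : w v • W v = 0 := by
          rw [hW]
          simp only [if_true, nsmul_eq_mul, mul_one, ZMod.natCast_self]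
        rwa [h2] at h1
      · have h1 := (isWeightedHomogeneous_X (R := k) W j).mul ((isWeightedHomogeneous_X (R := k) W v).pow (w j))
        have h2 : W j + w j • W v = 0 := by
          rw [hW]
          simp only [h, if_false, if_true, nsmul_eq_mul, mul_one, neg_add_cancel]
        rwa [h2] at h1
    simpa using hp.mul hj

/-- A cofactor `X_v^m · X^e` (`e` not involving `X_v`) has `W`-degree `0̄` when `m ≡ weight w e (mod w_v)`. [folklore] -/
theorem isWeightedHomogeneous_X_pow_mul_monomial (w : Fin n → ℕ) (v : Fin n) (W : Fin n → ZMod (w v))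
    (hW : W = fun j : Fin n => if j = v then (1 : ZMod (w v)) else -((w j : ℕ) : ZMod (w v)))
    (m : ℕ) (e : Fin n →₀ ℕ) (he : e v = 0)
    (h : ((m : ℕ) : ZMod (w v)) = ((Finsupp.weight w e : ℕ) : ZMod (w v))) :
    IsWeightedHomogeneous W ((X v : MvPolynomial (Fin n) k) ^ m * monomial e (1 : k)) 0 := by
  have h1 := ((isWeightedHomogeneous_X (R := k) W v).pow m).mul
    (isWeightedHomogeneous_monomial W e (1 : k) rfl)
  have h2 : m • W v + Finsupp.weight W e = 0 := by
    rw [weightW_of_apply_eq_zero w v W hW e he, ← h, hW]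
    simp only [if_true, nsmul_eq_mul, mul_one, add_neg_cancel]
  rwa [h2] at h1

/-! ## The two halves of the image computation, at the level of polynomials -/

/-- (⊆) **`θ_v` on the centre**: for `u ∈ I_N` (monomials of weighted degree `≥ N = c w_v`), `θ_v u = X_v^N · V` with
`V` of `W`-degree `0̄` (on a generator `X^b`: `V = X_v^{weight w b - N} X^{b - b_v e_v}`, of degree
`w_v b_v - N = 0̄`; `k[X]`-linear combinations by `isWeightedHomogeneous_rootCover`). [folklore] -/
theorem exists_factor_of_mem_span (w : Fin n → ℕ) (v : Fin n) (W : Fin n → ZMod (w v))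
    (hW : W = fun j : Fin n => if j = v then (1 : ZMod (w v)) else -((w j : ℕ) : ZMod (w v)))
    (N c : ℕ) (hcN : c * w v = N) (u : MvPolynomial (Fin n) k)
    (hu : u ∈ Ideal.span {m : MvPolynomial (Fin n) k | ∃ b : Fin n →₀ ℕ, N ≤ Finsupp.weight w b ∧
      m = MvPolynomial.monomial b 1}) :
    ∃ V : MvPolynomial (Fin n) k, IsWeightedHomogeneous W V 0 ∧
      MvPolynomial.aeval (fun j : Fin n => if j = v then (MvPolynomial.X v : MvPolynomial (Fin n) k) ^ (w v)
        else MvPolynomial.X j * MvPolynomial.X v ^ (w j)) u = X v ^ N * V := by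
  refine Submodule.span_induction ?_ ?_ ?_ ?_ hu
  · rintro x ⟨b, hb, rfl⟩
    refine ⟨X v ^ (Finsupp.weight w b - N) * monomial (b.erase v) 1, ?_, ?_⟩
    · refine isWeightedHomogeneous_X_pow_mul_monomial w v W hW _ _ (Finsupp.erase_same) ?_
      rw [Nat.cast_sub hb, weight_eq_erase_add w v b, ← hcN]
      push_cast
      rw [ZMod.natCast_self]
      ring
    · rw [aeval_rootCover_monomial, C_1, one_mul, ← mul_assoc, ← pow_add, Nat.add_sub_cancel' hb]
  · exact ⟨0, isWeightedHomogeneous_zero _ _ _, by rw [map_zero, mul_zero]⟩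
  · rintro x y - - ⟨V₁, hV₁, e₁⟩ ⟨V₂, hV₂, e₂⟩
    exact ⟨V₁ + V₂, hV₁.add hV₂, by rw [map_add, e₁, e₂, mul_add]⟩
  · rintro r x - ⟨V, hV, e⟩
    refine ⟨MvPolynomial.aeval (fun j : Fin n => if j = v then (MvPolynomial.X v : MvPolynomial (Fin n) k) ^ (w v)
        else MvPolynomial.X j * MvPolynomial.X v ^ (w j)) r * V, ?_, ?_⟩
    · simpa using (isWeightedHomogeneous_rootCover w v W hW r).mul hV
    · rw [smul_eq_mul, map_mul, e]
      ring

/-- (⊇) **Lifting degree-`0̄` polynomials through `θ_v` with controlled denominators**: for `U` of `W`-degree `0̄`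
there are `t` and `H ∈ I_N^t` with `θ_v H = X_v^{N t} · U` (monomialwise: `X^b ↦ X^{a(b)}`,
`a(b) = (b - b_v e_v) + ((N t + b_v - Σ_{j≠v} w_j b_j)/w_v) e_v`, integral by the degree-`0̄` congruence and
`t ≫ 0`, of weighted degree `N t + b_v ≥ N t`, so in `I_N^t` by Veronese saturation). [folklore] -/
theorem exists_lift_of_isWeightedHomogeneous (w : Fin n → ℕ) (v : Fin n) (hv : 0 < w v)
    (W : Fin n → ZMod (w v))
    (hW : W = fun j : Fin n => if j = v then (1 : ZMod (w v)) else -((w j : ℕ) : ZMod (w v)))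
    (N c : ℕ) (hcN : c * w v = N) (hc : 0 < c)
    (hsat : ∀ (K : ℕ) (b : Fin n →₀ ℕ), K * N ≤ Finsupp.weight w b →
      (MvPolynomial.monomial b (1 : k) : MvPolynomial (Fin n) k) ∈
        (Ideal.span {m : MvPolynomial (Fin n) k | ∃ b : Fin n →₀ ℕ, N ≤ Finsupp.weight w b ∧
          m = MvPolynomial.monomial b 1}) ^ K)
    (U : MvPolynomial (Fin n) k) (hU : IsWeightedHomogeneous W U 0) :
    ∃ (t : ℕ) (H : MvPolynomial (Fin n) k),
      H ∈ (Ideal.span {m : MvPolynomial (Fin n) k | ∃ b : Fin n →₀ ℕ, N ≤ Finsupp.weight w b ∧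
          m = MvPolynomial.monomial b 1}) ^ t ∧
      MvPolynomial.aeval (fun j : Fin n => if j = v then (MvPolynomial.X v : MvPolynomial (Fin n) k) ^ (w v)
        else MvPolynomial.X j * MvPolynomial.X v ^ (w j)) H = X v ^ (N * t) * U := by
  classical
  have hN : 0 < N := by
    rw [← hcN]
    exact Nat.mul_pos hc hv
  -- a uniform bound on the `X_v`-free weighted degrees of the monomials of `U`
  set t : ℕ := ∑ b ∈ U.support, Finsupp.weight w (b.erase v) with ht
  have hle : ∀ b ∈ U.support, Finsupp.weight w (b.erase v) ≤ N * t + b v := by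
    intro b hb
    calc Finsupp.weight w (b.erase v) ≤ t :=
          Finset.single_le_sum (f := fun b : Fin n →₀ ℕ => Finsupp.weight w (b.erase v))
            (fun _ _ => Nat.zero_le _) hb
      _ ≤ N * t := Nat.le_mul_of_pos_left t hN
      _ ≤ N * t + b v := Nat.le_add_right _ _
  -- the degree-`0̄` congruence makes the lifted `v`-exponent integral
  have hdvd : ∀ b ∈ U.support, w v ∣ N * t + b v - Finsupp.weight w (b.erase v) := by
    intro b hb
    have hwt : Finsupp.weight W b = 0 := hU (mem_support_iff.mp hb)
    rw [weightW_eq w v W hW b, sub_eq_zero] at hwt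
    rw [← ZMod.natCast_eq_zero_iff, Nat.cast_sub (hle b hb), Nat.cast_add, hwt, Nat.cast_mul, ← hcN,
      Nat.cast_mul, ZMod.natCast_self]
    ring
  -- the lifted exponent vectors
  let a : (Fin n →₀ ℕ) → (Fin n →₀ ℕ) := fun b =>
    b.erase v + Finsupp.single v ((N * t + b v - Finsupp.weight w (b.erase v)) / w v)
  have ha_v : ∀ b, a b v = (N * t + b v - Finsupp.weight w (b.erase v)) / w v := by
    intro b
    simp only [a, Finsupp.add_apply, Finsupp.erase_same, Finsupp.single_eq_same, zero_add]
  have ha_erase : ∀ b, (a b).erase v = b.erase v := by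
    intro b
    ext j
    simp only [a, Finsupp.erase_apply, Finsupp.add_apply, Finsupp.single_apply]
    split_ifs with h1 h2
    · rfl
    · exact absurd h2.symm h1
    · rw [add_zero]
  have hweight_a : ∀ b ∈ U.support, Finsupp.weight w (a b) = N * t + b v := by
    intro b hb
    rw [weight_eq_erase_add w v (a b), ha_erase, ha_v, Nat.div_mul_cancel (hdvd b hb)]
    have := hle b hb
    omega
  refine ⟨t, ∑ b ∈ U.support, monomial (a b) (coeff b U), ?_, ?_⟩
  · refine Ideal.sum_mem _ fun b hb => ?_
    have hC : (monomial (a b) (coeff b U) : MvPolynomial (Fin n) k) = C (coeff b U) * monomial (a b) 1 := by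
      rw [C_mul_monomial, mul_one]
    rw [hC]
    refine Ideal.mul_mem_left _ _ (hsat t (a b) ?_)
    rw [hweight_a b hb, mul_comm]
    exact Nat.le_add_right _ _
  · rw [map_sum]
    conv_rhs => rw [U.as_sum, Finset.mul_sum]
    refine Finset.sum_congr rfl fun b hb => ?_
    rw [aeval_rootCover_monomial, hweight_a b hb, ha_erase, monomial_eq_C_mul_X_pow_mul v b (coeff b U),
      pow_add]
    ring

/-! ## The stub -/

/-- **THE IMAGE OF A WEIGHTED BLOW-UP CHART IS THE WEIGHT-`0̄` SUBALGEBRA** (stub `stub_weightedChartImage` of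
the registered skeleton of line `Sketch`, §15 weighted cone engine). `k` a field, weights `w` on `X₀,…,X_{n-1}`, a
chart index `v` with `0 < w_v`, `N = c w_v` (`0 < c`), `I_N` the ideal of monomials of weighted degree `≥ N`,
Veronese-saturated; `θ = θ_v` the root-cover substitution `X_v ↦ X_v^{w_v}`, `X_j ↦ X_j X_v^{w_j}`; `f, g`
polynomials and `Θ : (k[X]/(f))[1/x_v^c] → (k[X]/(g))[1/x_v]` a ring map compatible with `θ`; `A ⊆ k[X]/(g)` the
classes of polynomials of `W`-degree `0̄` (`W = (X_v ↦ 1, X_j ↦ -w_j)` in `ℤ/w_v`). Then `Θ` maps the affine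
blow-up algebra `(k[X]/(f))[I_N/x_v^c]` into the image of `A`, and onto it: (⊆) by induction over
`Algebra.adjoin` — scalars `mk s ↦ mk (θ s)` of degree `0̄`, generators `mk u / x_v^c ↦ mk V` where
`θ u = X_v^N V` (`exists_factor_of_mem_span`) and `Θ (x_v^c)⁻¹ · x_v^N = 1`; (⊇) `mk U`, `U` of degree `0̄`, is
`Θ (mk H / (x_v^c)^t)` with `H ∈ I_N^t`, `θ H = X_v^{N t} U` (`exists_lift_of_isWeightedHomogeneous`), and
`mk H / (x_v^c)^t ∈ (k[X]/(f))[I_N/x_v^c]` (Stacks 052Q, `algebraMap_mul_invSelf_pow_mem_blowupAlgebra`).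
[folklore] -/
theorem stub_weightedChartImage : ∀ (k : Type) [Field k] (n : ℕ) (w : Fin n → ℕ) (v : Fin n), 0 < w v → ∀ (N c : ℕ), c * w v = N → 0 < c → (∀ (K : ℕ) (b : Fin n →₀ ℕ), K * N ≤ Finsupp.weight w b → (MvPolynomial.monomial b (1 : k) : MvPolynomial (Fin n) k) ∈ (Ideal.span {m : MvPolynomial (Fin n) k | ∃ b : Fin n →₀ ℕ, N ≤ Finsupp.weight w b ∧ m = MvPolynomial.monomial b 1}) ^ K) → ∀ (f g : MvPolynomial (Fin n) k) (θ : MvPolynomial (Fin n) k →ₐ[k] MvPolynomial (Fin n) k), θ = MvPolynomial.aeval (fun j : Fin n => if j = v then (MvPolynomial.X v : MvPolynomial (Fin n) k) ^ (w v) else MvPolynomial.X j * MvPolynomial.X v ^ (w j)) → ∀ (Θ : Localization.Away (Ideal.Quotient.mk (Ideal.span {f}) (MvPolynomial.X v) ^ c) →+* Localization.Away (Ideal.Quotient.mk (Ideal.span {g}) (MvPolynomial.X v))), (∀ s : MvPolynomial (Fin n) k, Θ (algebraMap (MvPolynomial (Fin n) k ⧸ Ideal.span {f}) (Localization.Away (Ideal.Quotient.mk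 (Ideal.span {f}) (MvPolynomial.X v) ^ c)) (Ideal.Quotient.mk (Ideal.span {f}) s)) = algebraMap (MvPolynomial (Fin n) k ⧸ Ideal.span {g}) (Localization.Away (Ideal.Quotient.mk (Ideal.span {g}) (MvPolynomial.X v))) (Ideal.Quotient.mk (Ideal.span {g}) (θ s))) → ∀ (A : Subalgebra k (MvPolynomial (Fin n) k ⧸ Ideal.span {g})), (∀ b : MvPolynomial (Fin n) k ⧸ Ideal.span {g}, b ∈ A ↔ ∃ U : MvPolynomial (Fin n) k, MvPolynomial.IsWeightedHomogeneous (fun j : Fin n => if j = v then (1 : ZMod (w v)) else -((w j : ℕ) : ZMod (w v))) U 0 ∧ Ideal.Quotient.mk (Ideal.span {g}) U = b) → (∀ z : Localization.Away (Ideal.Quotient.mk (Ideal.span {f}) (MvPolynomial.X v) ^ c), z ∈ Literature.AlgebraicGeometry.Resolution.blowupAlgebra ((Ideal.span {m : MvPolynomial (Fin n) k | ∃ b : Fin n →₀ ℕ, N ≤ Finsupp.weight w b ∧ m = MvPolynomial.monomial b 1}).map (Ideal.Quotient.mk (Ideal.span {f}))) (Ideal.Quotient.mk (Ideal.span {f})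 (MvPolynomial.X v) ^ c) → ∃ x : MvPolynomial (Fin n) k ⧸ Ideal.span {g}, x ∈ A ∧ Θ z = algebraMap (MvPolynomial (Fin n) k ⧸ Ideal.span {g}) (Localization.Away (Ideal.Quotient.mk (Ideal.span {g}) (MvPolynomial.X v))) x) ∧ (∀ x : MvPolynomial (Fin n) k ⧸ Ideal.span {g}, x ∈ A → ∃ z : Localization.Away (Ideal.Quotient.mk (Ideal.span {f}) (MvPolynomial.X v) ^ c), z ∈ Literature.AlgebraicGeometry.Resolution.blowupAlgebra ((Ideal.span {m : MvPolynomial (Fin n) k | ∃ b : Fin n →₀ ℕ, N ≤ Finsupp.weight w b ∧ m = MvPolynomial.monomial b 1}).map (Ideal.Quotient.mk (Ideal.span {f}))) (Ideal.Quotient.mk (Ideal.span {f}) (MvPolynomial.X v) ^ c) ∧ Θ z = algebraMap (MvPolynomial (Fin n) k ⧸ Ideal.span {g}) (Localization.Away (Ideal.Quotient.mk (Ideal.span {g}) (MvPolynomial.X v))) x) := by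
  intro k _ n w v hv N c hcN hc hsat f g θ hθ Θ hΘ A hA
  classical
  -- the weights of the root cover
  set W : Fin n → ZMod (w v) := fun j : Fin n => if j = v then (1 : ZMod (w v)) else -((w j : ℕ) : ZMod (w v))
    with hW
  -- `θ` on powers of the chart variable
  have hθXv : θ (MvPolynomial.X v ^ c) = MvPolynomial.X v ^ N := by
    rw [map_pow, hθ, MvPolynomial.aeval_X, if_pos rfl, ← pow_mul, mul_comm, hcN]
  -- `Θ` on the chart element `a = x_v^c` and on its inverse: `x_v^N · Θ (a⁻¹) = 1`
  have hinv : algebraMap (MvPolynomial (Fin n) k ⧸ Ideal.span {g})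
        (Localization.Away (Ideal.Quotient.mk (Ideal.span {g}) (MvPolynomial.X v)))
        (Ideal.Quotient.mk (Ideal.span {g}) (MvPolynomial.X v)) ^ N *
      Θ (IsLocalization.Away.invSelf (Ideal.Quotient.mk (Ideal.span {f}) (MvPolynomial.X v) ^ c)) = 1 := by
    have h2 := congrArg Θ (IsLocalization.Away.mul_invSelf
      (S := Localization.Away (Ideal.Quotient.mk (Ideal.span {f}) (MvPolynomial.X v) ^ c))
      (Ideal.Quotient.mk (Ideal.span {f}) (MvPolynomial.X v) ^ c))
    rw [map_mul, map_one] at h2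
    have h3 := hΘ (MvPolynomial.X v ^ c)
    rw [hθXv] at h3
    simp only [map_pow] at h2 h3
    rwa [h3] at h2
  -- every `θ s` has degree `0̄`
  have hθW : ∀ s : MvPolynomial (Fin n) k, IsWeightedHomogeneous W (θ s) 0 := fun s => by
    rw [hθ]
    exact isWeightedHomogeneous_rootCover w v W hW s
  refine ⟨?_, ?_⟩
  · -- (⊆) induction over the adjoin
    intro z hz
    change z ∈ Algebra.adjoin _ _ at hz
    refine Algebra.adjoin_induction ?_ ?_ ?_ ?_ hz
    · rintro x ⟨y, hy, rfl⟩
      obtain ⟨u, hu, rfl⟩ := (Ideal.mem_map_iff_of_surjective (Ideal.Quotient.mk (Ideal.span {f}))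
        Ideal.Quotient.mk_surjective).mp hy
      obtain ⟨V, hV, hθu⟩ := exists_factor_of_mem_span w v W hW N c hcN u hu
      refine ⟨Ideal.Quotient.mk (Ideal.span {g}) V, (hA _).mpr ⟨V, hV, rfl⟩, ?_⟩
      rw [map_mul, hΘ, hθ, hθu]
      simp only [map_mul, map_pow]
      rw [mul_right_comm, hinv, one_mul]
    · intro r
      obtain ⟨s, rfl⟩ := Ideal.Quotient.mk_surjective r
      exact ⟨Ideal.Quotient.mk (Ideal.span {g}) (θ s), (hA _).mpr ⟨θ s, hθW s, rfl⟩, hΘ s⟩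
    · rintro x y - - ⟨a₁, ha₁, e₁⟩ ⟨a₂, ha₂, e₂⟩
      exact ⟨a₁ + a₂, A.add_mem ha₁ ha₂, by rw [map_add, e₁, e₂, map_add]⟩
    · rintro x y - - ⟨a₁, ha₁, e₁⟩ ⟨a₂, ha₂, e₂⟩
      exact ⟨a₁ * a₂, A.mul_mem ha₁ ha₂, by rw [map_mul, e₁, e₂, map_mul]⟩
  · -- (⊇) lift a degree-`0̄` polynomial
    intro x hx
    obtain ⟨U, hU, rfl⟩ := (hA x).mp hx
    obtain ⟨t, H, hH, hθH⟩ := exists_lift_of_isWeightedHomogeneous w v hv W hW N c hcN hc hsat U hU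
    refine ⟨algebraMap (MvPolynomial (Fin n) k ⧸ Ideal.span {f})
        (Localization.Away (Ideal.Quotient.mk (Ideal.span {f}) (MvPolynomial.X v) ^ c))
        (Ideal.Quotient.mk (Ideal.span {f}) H) *
      IsLocalization.Away.invSelf (Ideal.Quotient.mk (Ideal.span {f}) (MvPolynomial.X v) ^ c) ^ t, ?_, ?_⟩
    · have hH' := Ideal.mem_map_of_mem (Ideal.Quotient.mk (Ideal.span {f})) hH
      rw [Ideal.map_pow] at hH'
      exact algebraMap_mul_invSelf_pow_mem_blowupAlgebra
        (a := Ideal.Quotient.mk (Ideal.span {f}) (MvPolynomial.X v) ^ c) t hH'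
    · rw [map_mul, hΘ, hθ, hθH]
      simp only [map_mul, map_pow]
      rw [pow_mul, mul_right_comm, ← mul_pow, hinv, one_pow, one_mul]

end Summit.ResolutionOfSingularities.ResolutionOfSingularities.Theorems.FInjectiveMacaulayfication.WeightedChartImage

end
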